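import Literature.AlgebraicGeometry.Frobenioids.MonoidRealification
import Literature.IUT.HodgeArakelov.GoodPrimeFrobenioidMonoidsProofs
import Literature.IUT.HodgeArakelov.GaussianMonoidsGood

/-!
# [IUTchII] Prop 4.1 (ii): `Ψ^R_cns := (Ψ_cns/Ψ_cns^×)^rlf ⥲ R_{≥0}(G_v)` as a realification (bridge +
# discharge)

S. Mochizuki, *Inter-universal Teichmüller theory II*, kurims Dec-2020 manuscript, Proposition 4.1 (ii)
p. 121: "a topological monoid `R_{≥0}(G_v)` equipped with a natural isomorphism
`Ψ^R_cns(G_v) := (Ψ_cns(G_v)/Ψ_cns(G_v)^×)^rlf ⥲ R_{≥0}(G_v)` — where the superscript '`×`' denotes the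
submonoid of units; the superscript '`rlf`' denotes the realification [which is isomorphic to `ℝ_{≥0}`]
of the monoid in parentheses [which is isomorphic to `ℚ_{≥0}`] — and a distinguished element
`log^{G_v}(p_v) ∈ R_{≥0}(G_v) — i.e., the element '`log^D_Φ(p_v)`' of [IUTchI], Example 3.5, (iii)"; the
same shape at `v ∈ V^bad` (Prop 4.2 (ii) p. 124, "`Ψ^R_{†F^⊢_v}`", "a unique isomorphism of monoids … that
maps the distinguished element … to the distinguished element") and at `v ∈ V^arc` (Prop 4.3 (ii)
p. 127, Prop 4.4 (ii) p. 130) [cite: Mochizuki2012, Prop 4.1 (ii) p.121].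

The statement file `GaussianMonoidsGood.lean` (p404520) recorded `R_{≥0}(−)` AS `ℝ≥0` with the element
`log(p_v)` (`LogRealDatum`), leaving the printed REALIFICATION implicit. The realification functor is
now in the tree: `Literature.AlgebraicGeometry.Frobenioids.Realification` (`M ⊗ ℝ_{≥0} := (M^∨)^∨`, [FrdI]
§0 p. 10, with `isRMonoprime_realification`: the realification of a monoprime monoid is `≅ ℝ_{≥0}`, and
`Realification.of_injective`). This file types the printed object and DISCHARGES the "natural
isomorphism" clause in the precise form the normalisation gives it:

* `PsiRlf Ψ := Realification (Associates Ψ)` — `(Ψ/Ψ^×)^rlf` for an abstract commutative monoid `Ψ`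
  (`Associates Ψ = Ψ/Ψ^×`), with `PsiRlf.logp p` = the image of `p ∈ Ψ` ("`log(p_v)`");
* `PsiRlf.logp_ne_one`: for `Ψ/Ψ^×` monoprime and `p` a non-unit, `log(p_v) ≠ 0` in the realification;
* `PsiRlf.existsUnique_iso` — PROVED: for `Ψ/Ψ^×` monoprime (printed: "isomorphic to `ℚ_{≥0}`"), `p` a
  non-unit, and any target datum `R_{≥0}(G_v) ∋ log(p_v) > 0` (`LogRealDatum`), there is a UNIQUE
  isomorphism of monoids `(Ψ/Ψ^×)^rlf ⥲ ℝ_{≥0}` carrying the class of `p` to `log(p_v)` (existence from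
  L1's `isRMonoprime_realification`, rescaled by `PointedHalfLine.scaleIso`; uniqueness from
  `PointedHalfLine.isoUnique_holds`, i.e. additive automorphisms of `ℝ≥0` are homotheties).

Claim key `Mochizuki2012` DISPUTED (D-0012): the content proved is elementary monoid theory; nothing here
asserts a disputed claim. The group-theoretic reconstruction of `Ψ_cns(G_v)` itself (Prop 4.1 (i),
[AbsTopIII] Cor 1.10) is not touched.
-/

noncomputable section

namespace Literature.IUT.HodgeArakelov

open Literature.AlgebraicGeometry.Frobenioids
open scoped NNReal

universe u

variable (Ψ : Type u) [CommMonoid Ψ]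

/-- `Ψ^R := (Ψ/Ψ^×)^rlf`, "the realification … of the monoid in parentheses", `Ψ/Ψ^×` being the monoid
modulo "the submonoid of units" ([IUTchII] Prop 4.1 (ii) p. 121; `Ψ^R_{†F^⊢_v}` Prop 4.2 (ii) p. 124),
rendered by [FrdI] §0's `Realification` of `Associates Ψ`. [cite: Mochizuki2012, Prop 4.1 (ii) p.121] -/
abbrev PsiRlf : Type u := Realification (Associates Ψ)

variable {Ψ}

/-- The image in `Ψ^R = (Ψ/Ψ^×)^rlf` of an element `p ∈ Ψ` — for `p = p_v` this is the element to be matched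
with "the distinguished element `log^{G_v}(p_v) ∈ R_{≥0}(G_v)`" ([IUTchII] Prop 4.1 (ii) p. 121).
[cite: Mochizuki2012, Prop 4.1 (ii) p.121] -/
def PsiRlf.logp (p : Ψ) : PsiRlf Ψ := Realification.of (Associates Ψ) (Associates.mk p)

namespace PsiRlf

/-- If `Ψ/Ψ^×` is monoprime ("isomorphic to `ℚ_{≥0}`", p. 121) then `Ψ^R` is `ℝ`-monoprime ("which is
isomorphic to `ℝ_{≥0}`", p. 121) — [FrdI] §0 via `isRMonoprime_realification`. [cite: Mochizuki2012, Prop 4.1 (ii) p.121] -/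
theorem isRMonoprime (h : IsMonoprime (Associates Ψ)) : IsRMonoprime (PsiRlf Ψ) :=
  isRMonoprime_realification h

/-- For `Ψ/Ψ^×` monoprime and `p` NOT a unit, the image of `p` in `Ψ^R` is not the neutral element
(`Realification.of` is injective on monoprime monoids, and `[p] ≠ 1` in `Ψ/Ψ^×`).
[cite: Mochizuki2012, Prop 4.1 (ii) p.121] -/
theorem logp_ne_one (h : IsMonoprime (Associates Ψ)) {p : Ψ} (hp : ¬ IsUnit p) : logp p ≠ 1 := by
  intro h1
  apply hp
  have h2 : Associates.mk p = 1 :=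
    Realification.of_injective h (by rw [map_one]; exact h1)
  exact Associates.mk_eq_one.mp h2

/-- Bookkeeping: `AddEquiv.toMultiplicative` of the identity is the identity. [folklore] -/
private theorem toMultiplicative_refl :
    AddEquiv.toMultiplicative (AddEquiv.refl ℝ≥0) = MulEquiv.refl (Multiplicative ℝ≥0) :=
  MulEquiv.ext fun _ => rfl

/-- An isomorphism of monoids `ℝ≥0 ⥲ ℝ≥0` (multiplicative notation) fixing a nonzero element is the
identity — `PointedHalfLine.isoUnique_holds` ([IUTchII] Prop 4.2 (ii) p. 124 "unique isomorphism") in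
multiplicative dress. [cite: Mochizuki2012, Prop 4.2 (ii) p.124] -/
theorem mulEquiv_nnreal_eq_refl (f : Multiplicative ℝ≥0 ≃* Multiplicative ℝ≥0) {a : ℝ≥0} (ha : 0 < a)
    (hf : f (Multiplicative.ofAdd a) = Multiplicative.ofAdd a) : f = MulEquiv.refl _ := by
  set g : ℝ≥0 ≃+ ℝ≥0 := AddEquiv.toMultiplicative.symm f with hg
  have hga : g a = a := by
    change Multiplicative.toAdd (f (Multiplicative.ofAdd a)) = a
    rw [hf, toAdd_ofAdd]
  let A : PointedHalfLine := ⟨a, ha⟩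
  have h1 : g = PointedHalfLine.scaleIso A A := PointedHalfLine.isoUnique_holds A A g hga
  have h2 : PointedHalfLine.scaleIso A A = AddEquiv.refl ℝ≥0 := by
    ext x
    change ((A.pt / A.pt * x : ℝ≥0) : ℝ) = x
    rw [div_self ha.ne', one_mul]
  have h3 : f = AddEquiv.toMultiplicative g := by rw [hg, Equiv.apply_symm_apply]
  rw [h3, h1, h2, toMultiplicative_refl]

/-- **[IUTchII] Prop 4.1 (ii) p. 121, the natural isomorphism `Ψ^R_cns(G_v) ⥲ R_{≥0}(G_v)` — DISCHARGED in
normalised form.** If `Ψ/Ψ^×` is monoprime ("isomorphic to `ℚ_{≥0}`") and `p ∈ Ψ` is not a unit, then for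
any `R_{≥0}(−)`-datum with distinguished element `log(p_v) > 0` (`LogRealDatum`; [IUTchI] Ex 3.5 (iii)
"`log^D_Φ(p_v)`") there is a UNIQUE isomorphism of monoids `(Ψ/Ψ^×)^rlf ⥲ ℝ_{≥0}` carrying the class of `p`
to `log(p_v)` (cf. Prop 4.2 (ii) p. 124 / Prop 4.4 (ii) p. 130: "a unique isomorphism of monoids … that
maps the distinguished element … to the distinguished element"). [cite: Mochizuki2012, Prop 4.1 (ii) p.121] -/
theorem existsUnique_iso (h : IsMonoprime (Associates Ψ)) {p : Ψ} (hp : ¬ IsUnit p) (D : LogRealDatum) :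
    ∃! e : PsiRlf Ψ ≃* Multiplicative ℝ≥0, e (logp p) = Multiplicative.ofAdd D.logp := by
  obtain ⟨⟨e₀⟩⟩ := isRMonoprime h
  -- the image of `log(p_v)` under an arbitrary identification with `ℝ≥0` is a nonzero `c`
  set c : ℝ≥0 := Multiplicative.toAdd (e₀ (logp p)) with hc
  have hc' : e₀ (logp p) = Multiplicative.ofAdd c := by rw [hc, ofAdd_toAdd]
  have hc0 : 0 < c := by
    refine pos_iff_ne_zero.mpr fun h0 => logp_ne_one h hp (e₀.injective ?_)
    rw [map_one, hc', h0]
    rfl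
  let C : PointedHalfLine := ⟨c, hc0⟩
  let A : PointedHalfLine := ⟨D.logp, D.logp_pos⟩
  -- rescale by the unique `ℝ≥0 ⥲ ℝ≥0` with `c ↦ log(p_v)`
  let e : PsiRlf Ψ ≃* Multiplicative ℝ≥0 :=
    e₀.trans (AddEquiv.toMultiplicative (PointedHalfLine.scaleIso C A))
  have he : e (logp p) = Multiplicative.ofAdd D.logp := by
    change Multiplicative.ofAdd
        (PointedHalfLine.scaleIso C A (Multiplicative.toAdd (e₀ (logp p)))) = _
    rw [← hc]
    exact congrArg Multiplicative.ofAdd (PointedHalfLine.scaleIso_pt C A)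
  refine ⟨e, he, ?_⟩
  -- uniqueness: two such isomorphisms differ by an automorphism of `ℝ≥0` fixing `log(p_v) ≠ 0`
  intro e' he'
  have hfix : (e.symm.trans e') (Multiplicative.ofAdd D.logp) = Multiplicative.ofAdd D.logp := by
    rw [MulEquiv.trans_apply, ← he, MulEquiv.symm_apply_apply, he', he]
  have hid := mulEquiv_nnreal_eq_refl (e.symm.trans e') D.logp_pos hfix
  ext x
  have := MulEquiv.congr_fun hid (e x)
  simp only [MulEquiv.trans_apply, MulEquiv.symm_apply_apply, MulEquiv.refl_apply] at this
  rw [this]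

/-- The normalised isomorphism `Ψ^R ⥲ ℝ_{≥0}` of Prop 4.1 (ii) (a choice of the unique one).
[cite: Mochizuki2012, Prop 4.1 (ii) p.121] -/
def toNNReal (h : IsMonoprime (Associates Ψ)) {p : Ψ} (hp : ¬ IsUnit p) (D : LogRealDatum) :
    PsiRlf Ψ ≃* Multiplicative ℝ≥0 :=
  (existsUnique_iso h hp D).exists.choose

/-- The normalised isomorphism carries the class of `p_v` to `log(p_v)`. [cite: Mochizuki2012, Prop 4.1 (ii) p.121] -/
theorem toNNReal_logp (h : IsMonoprime (Associates Ψ)) {p : Ψ} (hp : ¬ IsUnit p) (D : LogRealDatum) :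
    toNNReal h hp D (logp p) = Multiplicative.ofAdd D.logp :=
  (existsUnique_iso h hp D).exists.choose_spec

/-- Any isomorphism `Ψ^R ⥲ ℝ_{≥0}` with the printed normalisation IS the normalised one ("natural").
[cite: Mochizuki2012, Prop 4.1 (ii) p.121] -/
theorem eq_toNNReal (h : IsMonoprime (Associates Ψ)) {p : Ψ} (hp : ¬ IsUnit p) (D : LogRealDatum)
    (e : PsiRlf Ψ ≃* Multiplicative ℝ≥0) (he : e (logp p) = Multiplicative.ofAdd D.logp) :
    e = toNNReal h hp D :=
  (existsUnique_iso h hp D).unique he (toNNReal_logp h hp D)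

end PsiRlf

/-- `Ψ^ss_cns := Ψ_cns^× × Ψ^R_cns` with `Ψ^R` the GENUINE realification ([IUTchII] Prop 4.1 (ii) p. 121
"`Ψ^ss_cns(G_v) := Ψ_cns(G_v)^× × R_{≥0}(G_v)`", read before transport along `Ψ^R ⥲ R_{≥0}`), next to the
statement file's `ConstantMonoidDatum.SemiSimplified = Ψ^× × ℝ≥0`. [cite: Mochizuki2012, Prop 4.1 (ii) p.121] -/
abbrev SemiSimplifiedRlf (Ψ : Type u) [CommMonoid Ψ] : Type u := Ψˣ × PsiRlf Ψ

/-- Transport of `Ψ^× × Ψ^R` to `Ψ^× × ℝ_{≥0}` along the normalised isomorphism of Prop 4.1 (ii): the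
semi-simplification as typed in `GaussianMonoidsGood` (`Ψ^× × ℝ≥0`) is isomorphic to the one built from
the genuine realification. [cite: Mochizuki2012, Prop 4.1 (ii) p.121] -/
def semiSimplifiedRlfEquiv (h : IsMonoprime (Associates Ψ)) {p : Ψ} (hp : ¬ IsUnit p)
    (D : LogRealDatum) : SemiSimplifiedRlf Ψ ≃* Ψˣ × Multiplicative ℝ≥0 :=
  MulEquiv.prodCongr (MulEquiv.refl _) (PsiRlf.toNNReal h hp D)

end Literature.IUT.HodgeArakelov
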